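import Mathlib
import HarnessLib
import HarnessLib.Audit
import Summits.AtomisticToContinuum.Statement
import Literature.MathematicalPhysics.QuantumManyBody.PeriodicBoseGas
import Literature.MathematicalPhysics.QuantumManyBody.PeriodicBoseGasFourier

/-!
Route: BECInfraredUncertainty

CLOSED (retired) 2026-08-15T13:39:02Z by operator:999:1257524 — reason: not-a-thesis: assembly does not conclude the sub-problem Statement — note: D-0027 §2.1 audit (human 2026-08-15: routes that do not decide the summit are removed): the assembly concludes `Literature.MathematicalPhysics.QuantumManyBody.BoseGas.BoseEinsteinCondensation`, not the sub-problem statement; a NEW conforming route may be opened from the same idea (generated `closes . The file is kept as the record of this route; refuted decls are indexed as negative knowledge (`ledger negatives`).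

# Route BECInfraredUncertainty — infrared minimum uncertainty — phase Lévy weight × structure factor
≤ C (→ ¼) plus the Puff floor give torus BEC with no n₀ and no Lévy positivity

It suffices to show X = InfraredMinimumUncertainty ∧ PuffFloor for the POSITIVE MINIMISER Ψ of the
periodic N-body energy on the torus of
side L = (N/ρ)^{1/3}, for every potential of the smooth class (repulsive, finite, finite range, C²
as ṽ(x) = v(|x|), edge condition
‖D²ṽ‖ ≤ Cₑ√ṽ), at all small ρ and all large N. Objects (all read off the SAME state, no condensate
fraction anywhere): g(r) =
∫_cell dx ∫ dY Ψ(x+r,Y)Ψ(x,Y) = γ̄(r)/ρ (translation-averaged one-body density matrix, g(0) = 1),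
its Lévy weights ν_m = Re ĉ_m(log g)
(cell Fourier coefficients of log g, m ∈ ℤ³∖0, k = 2πm/L), the static structure factor S_m =
N⁻¹⟨|Σ_j e^{ik·x_j}|²⟩.
InfraredMinimumUncertainty (IMU, card infrared-minimum-uncertainty-quarter K1 in its load-bearing
bounded form): Π_m := N·ν_m·S_m ≤ C for
EVERY m ≠ 0, C = C(v), uniformly in N. PuffFloor (card P1′/(a)): S_m ≥ |k|/√(|k|² + Cρ) for every m
≠ 0. The planner's correction of the
card's assembly P5: the companion conjecture ID (ν ≥ 0, card levy-coherence-strings-vs-clouds) is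
NOT needed — Jensen (f₀ = V⁻¹∫g ≥ e^{ν₀}),
Parseval against a nonnegative kernel φ = V·η_κ∗η_κ supported in |r| ≤ 1/κ (φ̂ = |η̂(k/κ)|² ≥ 0) and
the provable short-distance bound
g(r) ≥ 1 − |r|²T/2N replace it: ν₀ = V⁻¹∫φ log g − Σ_{k≠0} φ̂(k)ν_k ≥ log(1 − τ/2κ²) − (C/N)Σ_{k≠0}
φ̂(k)/S_k = log(1 − τ/2κ²) − O(K³√ρ)
with κ = K√ρ, τ = T/N ≤ ρ‖ṽ‖₁/2; hence f₀ ≥ ½ for the positive minimiser, and fixed-N stability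
carries it to all δ(N)-near-minimisers:
SmoothPeriodicBEC (target, shared with route BECSumRuleBootstrap), then BoundaryTransferWeak
(shared, BECPeriodicReduction) and
HardCoreExtension (shared) give the conjunct. The card's sharp headline Π ≤ ¼ on the infrared window
is filed as QuarterLaw (crux, not
load-bearing).
Lean: `InfraredMinimumUncertainty ∧ PuffFloor`

## Assembly
Pure logic (checked sorry-free in Sketch.lean, theorem assembly_holds, axioms propext /
Classical.choice / Quot.sound): the five
statements feed IMUChainGlue, which yields SmoothPeriodicBEC; for a class potential v its body is
exactly the hypothesis of
BoundaryTransferWeak v, giving HasGroundStateBEC v ρ for small ρ; HardCoreExtension turns the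
class-restricted conclusion into the conjunct
Literature.MathematicalPhysics.QuantumManyBody.BoseGas.BoseEinsteinCondensation (=
BoseEinsteinCondensation of the summit). QuarterLaw is
deliberately outside the chain. Term: fun hI hP hS hM hN hG hB hH => hH (fun v a b c d => hB v a (hG
hM hN hS hP hI v a b c d)).

Rationale: WHY THIS LINE. Every T = 0 route needs an upper bound on infrared phase fluctuations; the classical
one (Pitaevskii–Stringari uncertainty inequality
n(q) ≥ n₀/4S(q) − ½, Stringari1995 §2.2 (9)–(11), PDF p. 74; PitaevskiiStringari1991;
Gavoret–Nozières' pole sharing, Griffin1993 §6.3 (6.31))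
is a LOWER bound with n₀ inside. IMU is its converse typed on a new pair of variables — the Lévy
weight ν_k of log g (MoraCastin2003 §4.3:
at Bogoliubov order ν_k = v_k²/N) against the structure factor of the same state — so that n₀
cancels: Bogoliubov gives the closed form
Π(x) = 1/[2(2+x)(1+x+√(x²+2x))] ↑ ¼ (x = ε_k/gn), Gavoret–Nozières + phonon saturation give Π → ¼
exactly in any superfluid, and the card's
56 exact ground states (2D/3D hard-core ED, Bose–Hubbard rings, XX chain to L = 256 with Π_1 =
0.24583, 0.24791, 0.24896) never exceed ¼.
The second input is the sum-rule school run as a LOWER bound on S: m₀ ≥ m₁^{3/2}m₃^{−1/2} with the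
f-sum rule and Puff's cubic moment
(Puff1965; doi:10.1103/physrevb.46.2974; Stringari1995 §2.3 (20)–(23), p. 77) gives the linear
anti-hyperuniformity floor S ≥ |k|/√(|k|²+Θ)
with no condensate assumed. Imported: sum rules / moment problems (many-body linear response),
Lévy–Khintchine bookkeeping on the
3-torus (harmonic analysis: Jensen + Parseval with a positive-definite compactly supported kernel),
exact diagonalisation evidence. What it
does that prior routes do not: BECSumRuleBootstrap dominates the longitudinal CURRENT and needs a
c-number split plus Var N̂₀ = o(N²);
BECSectorGap/BECInfraredBound bound OCCUPATIONS n_k (n₀ or a Landau floor inside); here the whole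
infrared difficulty is one dimensionless,
n₀-free, sign-free inequality between two measurable spectra, and the d-dependence sits in the
single lattice sum Σφ̂(k)/|k| (finite iff d ≥ 2).

RANKED CRUXES. #0 SmoothPeriodicBEC (target) — (shared verbatim with route BECSumRuleBootstrap, item
stmt-AtomisticToContinuum-6733) PeriodicBEC restricted to the smooth class: for every repulsive
finite-range v that is finite, C² as ṽ(x) = v(|x|) with ‖D²ṽ‖ ≤ Cₑ√ṽ, there is ρ₀ > 0 such that for
0 < ρ < ρ₀ there is c > 0 with: for all large N there is δ > 0 such that every periodic trial state
on the torus of side (N/ρ)^{1/3} with periodicEnergy ≤ E₀^per + δ has constant-mode occupation ≥ cN.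
(why it might fail: contains thermodynamic-limit BEC for smooth potentials (LSSY2005 Ch. 5: open;
Fournais2020 / arXiv:2603.20776 stop at L ≲ a(ρa³)^(−3/4−η)).) [LSSY2005, Fournais2020,
arXiv:2603.20776, arXiv:2510.20493]
#2 InfraredMinimumUncertainty (crux) — (card K1, bounded load-bearing form, all modes) for every
smooth-class v there are C ≥ 0 and ρ₀ > 0 such that for 0 < ρ < ρ₀, all large N = n+1 and every
positive minimiser Ψ of the periodic N-body energy on the torus of side L = (N/ρ)^{1/3}
(periodicEnergy = E₀^per < ∞, Ψ > 0 pointwise), for every m ∈ ℤ³∖0: N·ν_m·S_m ≤ C, where g(r) =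
∫_cell∫_{cell^n} Ψ(x+r,Y)Ψ(x,Y), ν_m = Re cellFourierCoeff(log g)(m), S_m = N⁻¹∫|Σ_j e_m(x_j)|²Ψ².
Bogoliubov: C = ¼ suffices at every k; GN: Π → ¼ as k → 0. [difficulty: open-problem] (why it might
fail: it is an n₀-free infrared bound (ν_k ≲ mc/2N|k| where S is linear): as hard as the 1/|k| law
for n_k; non-phonon gapless modes, or a log L in ν_k at the lowest modes beyond Bogoliubov order
(Gavoret–Nozières/Nepomnyashchii territory), would break uniformity in N.) [Stringari1995,
PitaevskiiStringari1991, GavoretNozieres1964, Griffin1993, MoraCastin2003,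
Literature.Barriers.AtomisticToContinuum.BogoliubovPerturbationInfrared]
#3 PuffFloor (crux) — (card P1′(a), linear anti-hyperuniformity floor) for every smooth-class v
there are C ≥ 0, ρ₀ > 0 such that for 0 < ρ < ρ₀, all large N and every positive minimiser Ψ on the
torus of side (N/ρ)^{1/3}, for every m ≠ 0 with k = 2πm/L: S_m ≥ |k|/√(|k|² + Cρ). Intended proof:
m₀ ≥ m₁^{3/2}M₃^{−1/2} from minimality (0 ≤ q_{H−E₀}(sA_kΨ − ρ_k†Ψ)) and Cauchy–Schwarz, f-sum m₁ =
N|k|², and Puff's cubic moment M₃ ≤ N|k|⁴(|k|² + c₁T/N + c₂E_Ψ[Σ_{i<j}|x_i−x_j|²|D²ṽ(x_i−x_j)|]/N)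
with both brackets O(ρ). [difficulty: L] (why it might fail: the potential part of m₃ needs a
no-clustering bound E[#pairs with |xᵢ−xⱼ|<R₀] ≤ C·NρR₀³ for the minimiser; the energy controls only
∫vg₂, not pairs in the soft edge of supp v, so Θ = O(ρ) may need a number-variance input.)
[Puff1965, doi:10.1103/physrevb.46.2974, Stringari1995, Feynman1954, LSSY2005]
#4 BoundaryTransferWeak (crux) — (shared verbatim with route BECPeriodicReduction, item
stmt-AtomisticToContinuum-0827) for each repulsive finite-range v, PeriodicBEC(v) implies ∃ρ₀>0
∀ρ∈(0,ρ₀) HasGroundStateBEC v ρ (Dirichlet ground state, mode-free λ_max via condensateNumber);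
expected proof: Neumann bracketing of interior sub-boxes + λ_max(γ) ≥ tr γ²/N. [difficulty: L] (why
it might fail: PeriodicBEC(v) is ground-state-only (δ after N); the Dirichlet ground state lies a
wall term ≫ δ above E₀^per, so no energy-comparison proof; only the ENERGY transfer is in print; BEC
can be boundary-condition sensitive.) [LSSY2005, arXiv:2203.01841, arXiv:2205.15284,
doi:10.1007/bf01608554]
#5 HardCoreExtension (crux) — (shared verbatim with route BECSumRuleBootstrap, item
stmt-AtomisticToContinuum-6737) ground-state BEC at all small densities for every potential of the
smooth class implies the conjunct for every repulsive finite-range potential (hard cores, shells,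
kinks included). [difficulty: XL] (why it might fail: no comparison or monotonicity of λ_max(γ) in v
is known; approximating a hard core by class members v_n ↑ gives BEC with ρ₀(v_n), c(v_n) possibly →
0; Dyson's lemma transfers energies only.) [LSSY2005, LiebSeiringerYngvason2005]
#6 QuarterLaw (crux) — (card K1 sharp form / P3, the headline; NOT load-bearing for the assembly)
for every smooth-class v and every window constant K > 0 there is ρ₀ > 0 such that for 0 < ρ < ρ₀,
all large N and every positive minimiser on the torus of side (N/ρ)^{1/3}: Π_m = N·ν_m·S_m ≤ ¼ for
every m ≠ 0 with |2πm/L| < K√ρ — conjugate domination with the Heisenberg constant, saturated from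
below as k → 0 (Bogoliubov closed form Π(x) = 1/[2(2+x)(1+x+√(x²+2x))]; card census: 56 exact ground
states, max Π always < ¼, XX chain Π₁ = 0.24896 at L = 256). [deps: InfraredMinimumUncertainty]
[difficulty: open-problem] (why it might fail: beyond-Bogoliubov corrections at fixed kξ are
O(√(ρa³)) and N → ∞ runs at fixed ρ, so an approach to ¼ from ABOVE by any positive amount at some
kξ refutes it (IMU with C > ¼ survives); the card's two-body Wigner-molecule delimiter shows the
constant is not universal outside fluids.) [Stringari1995, MoraCastin2003, GavoretNozieres1964,
Griffin1993]
#9 PositiveMinimiser (support) — for every smooth-class v, every N = n+1 ≥ 1 and L > 0 the periodic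
N-body energy has a minimiser in the C¹ periodic Bose class which is C³, has finite energy, and is
pointwise strictly positive (Rellich on the torus, elliptic regularity for V ∈ C², bosonic ground
state = absolute ground state, Perron–Frobenius / positivity improvement). [difficulty: L]
[ReedSimonIV1978, LSSY2005]
#9 NearMinimiserStability (support) — (shared verbatim with route BECSumRuleBootstrap, item
stmt-AtomisticToContinuum-6740) at fixed N, L: for every ε > 0 there is δ > 0 such that every
δ-near-minimiser Φ has condensateOccupation ≥ that of a minimiser Ψ minus εN (discrete spectrum,
simple ground state; n₀ is 2N-Lipschitz in L²). [difficulty: M] [ReedSimonIV1978, LSSY2005]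
#9 ShortDistanceCoherence (support) — (companion card M5 / kinetic short-distance coherence,
provable now) for every periodic C¹ trial state Ψ of N = n+1 bosons on the torus of side L > 0 with
finite kinetic energy T = ∫_{cell^N}|∇Ψ|² and every r ∈ ℝ³: g(r) :=
∫_cell∫_{cell^n}|Ψ(x+r,Y)||Ψ(x,Y)| ≥ 1 − |r|²T/(2N). Proof: 1 − Re∫∫Ψ(x+r,Y)Ψ̄(x,Y) = ½‖Ψ(·+r) − Ψ‖²
≤ ½|r|²∫|∇₁Ψ|² = |r|²T/2N by periodicity, the fundamental theorem along the segment and Bose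
symmetry. [difficulty: provable-now] [PitaevskiiStringari1991, LSSY2005]
#9 IMUChainGlue (support) — (glue of the thesis; kind glue) PositiveMinimiser →
NearMinimiserStability → ShortDistanceCoherence → PuffFloor → InfraredMinimumUncertainty →
SmoothPeriodicBEC. Bookkeeping for fixed smooth-class v: (i) n₀(Ψ)/N = V⁻¹∫_cell g for Ψ > 0 (unfold
condensateOccupation, substitute x' = x + r using periodicity); (ii) Jensen: log(V⁻¹∫g) ≥ V⁻¹∫log g
= ĉ₀(log g); (iii) Parseval on the cell with φ = V·(η_κ∗η_κ), η ∈ C_c^∞(B_{1/2}), η ≥ 0, ∫η = 1, η_κ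
= κ³η(κ·): ĉ₀(log g) = V⁻¹∫φ log g − Σ_{m≠0} |η̂(k/κ)|² ν_m; (iv) ShortDistanceCoherence + T ≤
periodicEnergy = E₀^per ≤ ρ‖ṽ‖₁N/2 (constant trial state) give V⁻¹∫φ log g ≥ log(1 − ‖ṽ‖₁/4K²) with
κ = K√ρ, 1/κ < L/2; (v) IMU + PuffFloor: ν_m ≤ C₁√(|k|²+C₂ρ)/(N|k|), and the lattice sums
Σ_m|η̂(k/κ)|² ≤ c_ηVκ³, Σ_{m≠0}|η̂(k/κ)|²/|k| ≤ c'_ηVκ² (L ≥ 1/κ) give Σ ≤ C₁(c_ηK³ + c'_η√C₂K²)√ρ;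
(vi) choose K² ≥ 2‖ṽ‖₁, then ρ₀ small: n₀(Ψ) ≥ N/2 for the positive minimiser, and
NearMinimiserStability with ε = ¼ yields δ > 0 with n₀ ≥ N/4 for all δ-near-minimisers, i.e.
SmoothPeriodicBEC with c = ¼. [difficulty: L] [Stringari1995, MoraCastin2003, LSSY2005]

TWO-LAYER PLAN. Foreseen glued splits (k ≤ 3, depth 1), filed only after a crux moves:
InfraredMinimumUncertainty ⇐ InfraredWindowIMU (Π_m ≤ C for
|k| < K√ρ) → UltravioletLevyTail ((ν_m)₊ ≤ C/(N S_m) for |k| ≥ K√ρ, where S → 1; the companion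
card's ID would also serve here) →
InfraredMinimumUncertainty; alternatively the card's ENGINE K2: InfraredMinimumUncertainty ⇐
SectorGapFloor (route BECSectorGap, item
stmt-AtomisticToContinuum-5149, a Landau-type floor on the particle–hole sector gap) →
StabilityTransfer (ground-state stability
⟨A†(H−E₀)A⟩ ≥ 0 with A = a₀†a_k/√N, ρ_k re-typed to bound ν_kS_k instead of n_k) →
InfraredMinimumUncertainty. PuffFloor ⇐ CurrentSumRule
(shared with BECSumRuleBootstrap, stmt-AtomisticToContinuum-6738: m₂² ≤ m₁M₃ at t = 1) →
PairCountBound (E[#{i<j : |xᵢ−xⱼ| < R₀}] ≤ CNρR₀³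
for the minimiser) → PuffFloor (glue: Cauchy–Schwarz m₁² ≤ m₀m₂ and the edge condition).
IMUChainGlue ⇐ LevyJensenParseval (steps i–iii) →
LatticeKernelSums (step v) → IMUChainGlue.

KILL CRITERIA. ¬InfraredMinimumUncertainty (Π_k unbounded in N at small k for torus minimisers of
some smooth v at arbitrarily small ρ — it would also
contradict Gavoret–Nozières pole sharing) closes the route: close --reason
refuted:InfraredMinimumUncertainty. ¬PuffFloor (sub-linear S at
small k, i.e. hyperuniform-like minimisers, or clustering making Θ ≫ ρ) forces a pivot: restate with
Θ = C(v)ρ^θ, θ > 0 (the glue tolerates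
any Θ → 0) or import LongWaveStructureBound (BECSumRuleBootstrap, stmt-AtomisticToContinuum-6736);
if S is genuinely sub-linear the line is
dead. ¬QuarterLaw does NOT close the route (repair = drop QuarterLaw; C > ¼ is
load-bearing-compatible) but retires the card's saturation
claim as negative knowledge. ¬HardCoreExtension: pivot the target to the smooth class (conjunct then
needs the comparison routes).
¬BoundaryTransferWeak kills every torus route's last step, not the mechanism. PeriodicBEC /
SmoothPeriodicBEC proved elsewhere moots items
0, 2, 3 and the supports.

NOT DECOMPOSED YET. The IR/UV split of IMU and its engine (sector floor vs. direct variational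
proof); the pair-count input of PuffFloor; the kernel sums and the
n₀ = (N/V)∫g identity inside IMUChainGlue (prover lemmas, --supports IMUChainGlue);
positivity/uniqueness facts behind PositiveMinimiser;
everything about ID (left to the companion card's own route — this assembly does not use the sign of
ν); d = 2, T > 0 and hard cores (only via
HardCoreExtension) are out of scope; no item asserts the compound-Poisson structure of n_k.

CHEAPEST FALSIFIER. QuarterLaw/IMU on exact ground states: the half-filled XX ring (free fermions,
exactly solvable) — run by the card's author: Π₁ = 0.24583 (L=64),
0.24791 (128), 0.24896 (256), all below ¼ with deficit ∝ 1/L; 31 hard-core ED tori in d = 2, 3 and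
Bose–Hubbard rings: max Π < ¼ (card P4).
Next cheapest (kit, few node-hours): worm/PIGS QMC for 3D soft spheres, N = 64–512, ρa³ = 10⁻⁴…10⁻²:
Π at the 10 smallest |k| (S(k) routine;
ν_k from log G(r)) — an approach to ¼ from above kills QuarterLaw, growth with N kills IMU; and a
Bogoliubov–de Gennes check that
S(k) ≥ |k|/√(|k|²+Cρ) holds with C = O(‖ṽ‖₁) for the LHY-corrected structure factor (PuffFloor's
constant). Lookup falsifier: a printed
converse of Pitaevskii–Stringari (9) — searched (Novelty), none found.

NUMBERS. Bogoliubov (ħ = 2m = 1, gn = 8πρa): Π(x) = 1/[2(2+x)(1+x+√(x²+2x))], x = k²/8πρa: Π(0⁺) =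
¼, Π(1) = 1/(6(2+√3)) = 0.04466, Π ≈ 1/4x² UV;
S(k) = k²/√(k⁴+16πρak²) ≥ |k|/√(|k|²+16πρa) (PuffFloor with C = 16πa at Bogoliubov level); ν_k =
v_k²/N, Σ_k|k|²ν_k = T/N ≤ 4πρa(1+O(Y^{1/3})).
Card census: 56 instances, 0 violations of Π ≤ ¼; half-filled rings L = 8…20: 0.2155…0.2366; XX
chain L = 64/128/256: 0.24583/0.24791/0.24896.
Glue constants: κ = K√ρ, K² ≥ 2‖ṽ‖₁ gives V⁻¹∫φ log g ≥ log ¾; error C₁(c_ηK³ + c'_η√C₂K²)√ρ; target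
f₀ ≥ ½, c = ¼ after stability.
Items at open: 11 (5 cruxes, 1 target, 4 supports, 1 assembly); shared by signature: 6733, 6737,
6740 (BECSumRuleBootstrap), 0827 (BECPeriodicReduction).

DEFINITION REQUESTS. None needed at open: everything is inline over
Literature.MathematicalPhysics.QuantumManyBody.BoseGas.{PeriodicTrialState, periodicEnergy,
periodicGroundStateEnergy, condensateOccupation, cell, cellN, cellWave, cellFourierCoeff,
latticeVec, sideLength, kineticDensity,
IsRepulsiveFiniteRange, HasGroundStateBEC, BoseEinsteinCondensation} (lean check rc 0). Nice to have
later (would shorten items 2, 3, 6 and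
the glue): levyWeight N L Ψ m, structureFactor N L Ψ m, averagedDensityMatrix N L Ψ r in
Literature/MathematicalPhysics/QuantumManyBody.

Novelty: Searches (2026-08-15): `lit search --hybrid "uncertainty principle inequality momentum distribution
static structure factor Bose condensate lower bound"` (8 held books: Stringari1995 ch. pp. 73–77
read — (9)–(11), (14)–(23); Griffin1993; LSSY2005; Lipparini 2008 p. 469 Puff m₃); `lit vsearch` on
the IMU statement in prose (8 books, Gaussian/Bogoliubov level only); `lit search --source crossref
"sum rules lower bound static structure factor third moment Bose"` (Singh–Pathak 1973 electron
liquid, Stringari1995) and `"Stringari sum rules density particle excitations Bose superfluids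
1992"` (doi:10.1103/physrevb.46.2974); `lit galaxy search --star all` ×3 ("momentum distribution
structure factor uncertainty Bose condensate inequality", "uncertainty principle and Bose-Einstein
condensation", "logarithm of the one-body density matrix": 0 rows each); `lit frontier
AtomisticToContinuum --since 2021` (30 descendants: arXiv:2510.20493, 2603.20776, 2605.06844 … all
energy/localisation, none sum-rule or Lévy based); `lit bridges AtomisticToContinuum --cross any`
(no Bose bridge); the 43 route files of the sub grepped for Lévy/log γ/structure factor×occupation
(none); S2/searchd unavailable this session (timed out).
Nearest prior art found: PitaevskiiStringari1991 / Stringari1995 §2.2 (9)–(11)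
(doi:10.1017/cbo9780511524240.007) — the REVERSE inequality n(q) ≥ n₀/4S(q) − ½ with n₀ inside, used
for the d = 1 no-go; Puff1965 and doi:10.1103/physrevb.46.2974 — the cubic moment, used for upper  [refs: 10.1103/physrevb.46.2974, 10.1017/cbo9780511524240.007, 2510.20493, doi:10.1103/physrevb.46.2974, doi:10.1017/cbo9780511524240.007, Stringari1995, Griffin1993, LSSY2005, PitaevskiiStringari1991, Puff1965, MoraCastin2003, GavoretNozieres1964]

Barriers (technique_class: conjugate-domination, Levy-weight, sum-rules): - technique_class: conjugate-domination, Levy-weight, sum-rules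
- Literature.Barriers.AtomisticToContinuum.PitaevskiiStringariOneDimension: IMU and PuffFloor are
dimension-blind and TRUE in d = 1 (XX chain saturates Π → ¼ from below); the barrier's content is
relocated exactly into the glue's lattice sum Σ_{m≠0}φ̂(k)/|k| ≍ Vκ² in d = 3 (≍ ∫_{|k|<κ}d^dk/|k|,
finite iff d ≥ 2; in d = 1 it is the Luttinger logarithm and the chain concludes nothing) — evaded
structurally, not by an estimate insensitive to d.
- Literature.Barriers.AtomisticToContinuum.PitaevskiiStringariOneDimensionNarrow: the entry itself
names the one admissible evasion — the infrared summability L^{−d}Σ_{0<|k|≤κL}L/|k| = O(1) ⇔ d ≥ 2 —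
and that is literally step (v) of IMUChainGlue (Σ_{m≠0}φ̂(k)/|k| ≤ c′Vκ²); IMU and PuffFloor are
dimension-free and consistent with clause (1): both hold in d = 1, where the same sum is the log L/K
depletion.
- Literature.Barriers.AtomisticToContinuum.HohenbergLowDimensionNarrow: positive-temperature
Bogoliubov-inequality class; this route is T = 0 and consumes no thermal inequality; the shared
token sum-rules enters only through minimality of the ground state (m₂² ≤ m₁m₃, m₁² ≤ m₀m₂) — not
engaged beyond the d-count already recorded.
- Literature.Barriers.AtomisticToContinuum.OneDimensionalHardCoreNarrow:
dimension/coupling-independent trial-function arguments; evaded as above (the d ≥ 2 lattice sum is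
used explicitly) and the cruxes are stated for d = 3 smooth-class minimisers

History (route lifecycle, newest last):
- 2026-08-15T13:39:02Z · CLOSED retired — not-a-thesis: assembly does not conclude the sub-problem Statement (operator:999:1257524)

sub-problem: BoseEinsteinCondensation · status: closed(retired) · opened planner-plancard-AtomisticToContinuum-BoseEin-9a5bb403-0 2026-08-15T12:38:24Z · rev 0 · ledger route-AtomisticToContinuum-BECInfraredUncertainty
GENERATED by the gate from the ledger (D-0016/17). Provers cite these decls: `theorem foo : Summit.AtomisticToContinuum.BoseEinsteinCondensation.Theses.BECInfraredUncertainty.<Decl> := …` in Summits/AtomisticToContinuum/BoseEinsteinCondensation/Theorems/<Name>.lean.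
-/

namespace Summit.AtomisticToContinuum.BoseEinsteinCondensation.Theses.BECInfraredUncertainty

open scoped BigOperators Topology Manifold Classical MeasureTheory ProbabilityTheory Matrix InnerProductSpace ComplexConjugate ContinuousMap
open Filter Set Function TopologicalSpace MeasureTheory

attribute [summit_statement] _root_.BoseEinsteinCondensation

/-- item stmt-AtomisticToContinuum-6733 · target · rank 0 · closed · moot by None · by planner
why it might fail: contains thermodynamic-limit BEC for smooth potentials (LSSY2005 Ch. 5: open; Fournais2020 / arXiv:2603.20776 stop at L ≲ a(ρa³)^(−3/4−η)).
sources: LSSY2005, Fournais2020, arXiv:2603.20776, arXiv:2510.20493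
[target] PeriodicBEC (route BECPeriodicReduction, item 0826) restricted to the smooth class: for
every repulsive finite-range v that is finite, C² as ṽ(x) = v(|x|) on ℝ³, with ‖D²ṽ(x)‖ ≤ Cₑ√ṽ(x)
(edge condition; e.g. (R₀²−|x|²)₊⁴), there is ρ₀ > 0 such that for 0 < ρ < ρ₀ there is c > 0 with:
for all large N there is δ > 0 such that every periodic trial state on the torus of side (N/ρ)^{1/3}
with periodicEnergy ≤ E₀^per + δ has constant-mode occupation ≥ cN. -/
@[route_item "route-AtomisticToContinuum-BECInfraredUncertainty"]
def SmoothPeriodicBEC : Prop :=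
  open Literature.MathematicalPhysics.QuantumManyBody.BoseGas in ∀ v : ℝ → ENNReal, IsRepulsiveFiniteRange v → (∀ r, v r ≠ ⊤) → ContDiff ℝ 2 (fun x : Space => (v ‖x‖).toReal) → (∃ Cₑ : ℝ, ∀ x : Space, ‖iteratedFDeriv ℝ 2 (fun x : Space => (v ‖x‖).toReal) x‖ ≤ Cₑ * Real.sqrt ((v ‖x‖).toReal)) → ∃ ρ₀ : ℝ, 0 < ρ₀ ∧ ∀ ρ : ℝ, 0 < ρ → ρ < ρ₀ → ∃ c : ℝ, 0 < c ∧ ∀ᶠ N : ℕ in Filter.atTop, ∃ δ : ENNReal, 0 < δ ∧ ∀ Ψ : PeriodicTrialState N (sideLength ρ N), periodicEnergy v Ψ ≤ periodicGroundStateEnergy v N (sideLength ρ N) + δ → ENNReal.ofReal (c * N) ≤ condensateOccupation N (sideLength ρ N) Ψ.ψ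

/-- item stmt-AtomisticToContinuum-8322 · crux · rank 2 · closed · moot by None · by planner
why it might fail: it is an n₀-free infrared bound (ν_k ≲ mc/2N|k| where S is linear): as hard as the 1/|k| law for n_k; non-phonon gapless modes, or a log L in ν_k at the lowest modes beyond Bogoliubov order (Gavoret–Nozières/Nepomnyashchii territory), would break uniformity in N.
sources: Stringari1995, PitaevskiiStringari1991, GavoretNozieres1964, Griffin1993, MoraCastin2003, Literature.Barriers.AtomisticToContinuum.BogoliubovPerturbationInfrared
[crux] (card K1, bounded load-bearing form, all modes) for every smooth-class v there are C ≥ 0 and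
ρ₀ > 0 such that for 0 < ρ < ρ₀, all large N = n+1 and every positive minimiser Ψ of the periodic
N-body energy on the torus of side L = (N/ρ)^{1/3} (periodicEnergy = E₀^per < ∞, Ψ > 0 pointwise),
for every m ∈ ℤ³∖0: N·ν_m·S_m ≤ C, where g(r) = ∫_cell∫_{cell^n} Ψ(x+r,Y)Ψ(x,Y), ν_m = Re
cellFourierCoeff(log g)(m), S_m = N⁻¹∫|Σ_j e_m(x_j)|²Ψ². Bogoliubov: C = ¼ suffices at every k; GN:
Π → ¼ as k → 0. [difficulty: open-problem] -/
@[route_item "route-AtomisticToContinuum-BECInfraredUncertainty"]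
def InfraredMinimumUncertainty : Prop :=
  open Literature.MathematicalPhysics.QuantumManyBody.BoseGas in ∀ v : ℝ → ENNReal, IsRepulsiveFiniteRange v → (∀ r, v r ≠ ⊤) → ContDiff ℝ 2 (fun x : Space => (v ‖x‖).toReal) → (∃ Cₑ : ℝ, ∀ x : Space, ‖iteratedFDeriv ℝ 2 (fun x : Space => (v ‖x‖).toReal) x‖ ≤ Cₑ * Real.sqrt ((v ‖x‖).toReal)) → ∃ C : ℝ, 0 ≤ C ∧ ∃ ρ₀ : ℝ, 0 < ρ₀ ∧ ∀ ρ : ℝ, 0 < ρ → ρ < ρ₀ → ∀ᶠ n : ℕ in Filter.atTop, ∀ Ψ : PeriodicTrialState (n + 1) (sideLength ρ (n + 1)), (let L : ℝ := sideLength ρ (n + 1); let g : Space → ℝ := fun r => ∫ x in cell L, ∫ Y in cellN n L, ‖Ψ.ψ (Matrix.vecCons (x + r) Y)‖ * ‖Ψ.ψ (Matrix.vecCons x Y)‖; let ν : (Fin 3 → ℤ) → ℝ := fun m => (cellFourierCoeff L (fun r : Space => ((Real.log (g r) : ℝ) : ℂ)) m).re; let S : (Fin 3 → ℤ) → ℝ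 := fun m => ((n : ℝ) + 1)⁻¹ * ∫ X in cellN (n + 1) L, ‖∑ j : Fin (n + 1), cellWave L m (X j)‖ ^ 2 * ‖Ψ.ψ X‖ ^ 2; periodicEnergy v Ψ = periodicGroundStateEnergy v (n + 1) L → periodicEnergy v Ψ ≠ ⊤ → (∀ X, Ψ.ψ X = (‖Ψ.ψ X‖ : ℂ)) → (∀ X, Ψ.ψ X ≠ 0) → ∀ m : Fin 3 → ℤ, m ≠ 0 → ((n : ℝ) + 1) * ν m * S m ≤ C)

/-- item stmt-AtomisticToContinuum-8323 · crux · rank 3 · closed · moot by None · by planner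
why it might fail: the potential part of m₃ needs a no-clustering bound E[#pairs with |xᵢ−xⱼ|<R₀] ≤ C·NρR₀³ for the minimiser; the energy controls only ∫vg₂, not pairs in the soft edge of supp v, so Θ = O(ρ) may need a number-variance input.
sources: Puff1965, doi:10.1103/physrevb.46.2974, Stringari1995, Feynman1954, LSSY2005
[crux] (card P1′(a), linear anti-hyperuniformity floor) for every smooth-class v there are C ≥ 0, ρ₀
> 0 such that for 0 < ρ < ρ₀, all large N and every positive minimiser Ψ on the torus of side
(N/ρ)^{1/3}, for every m ≠ 0 with k = 2πm/L: S_m ≥ |k|/√(|k|² + Cρ). Intended proof: m₀ ≥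
m₁^{3/2}M₃^{−1/2} from minimality (0 ≤ q_{H−E₀}(sA_kΨ − ρ_k†Ψ)) and Cauchy–Schwarz, f-sum m₁ =
N|k|², and Puff's cubic moment M₃ ≤ N|k|⁴(|k|² + c₁T/N + c₂E_Ψ[Σ_{i<j}|x_i−x_j|²|D²ṽ(x_i−x_j)|]/N)
with both brackets O(ρ). [difficulty: L] -/
@[route_item "route-AtomisticToContinuum-BECInfraredUncertainty"]
def PuffFloor : Prop :=
  open Literature.MathematicalPhysics.QuantumManyBody.BoseGas in ∀ v : ℝ → ENNReal, IsRepulsiveFiniteRange v → (∀ r, v r ≠ ⊤) → ContDiff ℝ 2 (fun x : Space => (v ‖x‖).toReal) → (∃ Cₑ : ℝ, ∀ x : Space, ‖iteratedFDeriv ℝ 2 (fun x : Space => (v ‖x‖).toReal) x‖ ≤ Cₑ * Real.sqrt ((v ‖x‖).toReal)) → ∃ C : ℝ, 0 ≤ C ∧ ∃ ρ₀ : ℝ, 0 < ρ₀ ∧ ∀ ρ : ℝ, 0 < ρ → ρ < ρ₀ → ∀ᶠ n : ℕ in Filter.atTop, ∀ Ψ : PeriodicTrialState (n + 1) (sideLength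 ρ (n + 1)), (let L : ℝ := sideLength ρ (n + 1); let S : (Fin 3 → ℤ) → ℝ := fun m => ((n : ℝ) + 1)⁻¹ * ∫ X in cellN (n + 1) L, ‖∑ j : Fin (n + 1), cellWave L m (X j)‖ ^ 2 * ‖Ψ.ψ X‖ ^ 2; let kn : (Fin 3 → ℤ) → ℝ := fun m => ‖((2 * Real.pi / L) • latticeVec 1 m)‖; periodicEnergy v Ψ = periodicGroundStateEnergy v (n + 1) L → periodicEnergy v Ψ ≠ ⊤ → (∀ X, Ψ.ψ X = (‖Ψ.ψ X‖ : ℂ)) → (∀ X, Ψ.ψ X ≠ 0) → ∀ m : Fin 3 → ℤ, m ≠ 0 → kn m / Real.sqrt (kn m ^ 2 + C * ρ) ≤ S m)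

/-- item stmt-AtomisticToContinuum-0827 · crux · rank 4 · open · by planner
why it might fail: PeriodicBEC(v) is ground-state-only (δ after N); the Dirichlet ground state lies a wall term ≫ δ above E₀^per, so no energy-comparison proof; only the ENERGY transfer is in print; BEC can be boundary-condition sensitive.
sources: LSSY2005, arXiv:2203.01841, arXiv:2205.15284, doi:10.1007/bf01608554
[crux] BoundaryTransferWeak (mode-free boundary-condition transfer, per potential): for each
repulsive finite-range v, PeriodicBEC(v) implies ∃ρ₀>0 ∀ρ∈(0,ρ₀) HasGroundStateBEC v ρ (Dirichlet
ground state, λ_max(γ) ≥ cN via condensateNumber). Not glue: near-minimiser slacks are O(N/L²) while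
Dirichlet/periodic energies differ by a boundary term ≫ N/L², so no energy-comparison proof;
expected route: Neumann bracketing of interior sub-boxes (−Δ_Dir ≥ ⊕−Δ_Neu, v ≥ 0) + a mode-free
criterion (λ_max ≥ tr γ²/N). Only the ENERGY analogue is in print (LiebSeiringerSolovejYngvason2005
Ch. 2 after (2.8)). v ≡ 0: hypothesis and conclusion both true. -/
@[route_item "route-AtomisticToContinuum-BECInfraredUncertainty"]
def BoundaryTransferWeak : Prop :=
  ∀ v : ℝ → ENNReal, Literature.MathematicalPhysics.QuantumManyBody.BoseGas.IsRepulsiveFiniteRange v → (∃ ρ₀ : ℝ, 0 < ρ₀ ∧ ∀ ρ : ℝ, 0 < ρ → ρ < ρ₀ → ∃ c : ℝ, 0 < c ∧ ∀ᶠ N : ℕ in Filter.atTop, ∃ δ : ENNReal, 0 < δ ∧ ∀ Ψ : Literature.MathematicalPhysics.QuantumManyBody.BoseGas.PeriodicTrialState N (Literature.MathematicalPhysics.QuantumManyBody.BoseGas.sideLength ρ N), Literature.MathematicalPhysics.QuantumManyBody.BoseGas.periodicEnergy v Ψ ≤ Literature.MathematicalPhysics.QuantumManyBody.BoseGas.periodicGroundStateEnergy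 v N (Literature.MathematicalPhysics.QuantumManyBody.BoseGas.sideLength ρ N) + δ → ENNReal.ofReal (c * N) ≤ Literature.MathematicalPhysics.QuantumManyBody.BoseGas.condensateOccupation N (Literature.MathematicalPhysics.QuantumManyBody.BoseGas.sideLength ρ N) Ψ.ψ) → ∃ ρ₀ : ℝ, 0 < ρ₀ ∧ ∀ ρ : ℝ, 0 < ρ → ρ < ρ₀ → Literature.MathematicalPhysics.QuantumManyBody.BoseGas.HasGroundStateBEC v ρ

/-- item stmt-AtomisticToContinuum-6737 · crux · rank 5 · closed · moot by None · by planner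
why it might fail: no comparison or monotonicity of λ_max(γ) in v is known; approximating a hard core by class members v_n ↑ gives BEC with ρ₀(v_n), c(v_n) possibly → 0; Dyson's lemma transfers energies only.
sources: LSSY2005, LiebSeiringerYngvason2005
[crux] ground-state BEC at all small densities for every potential of the smooth class (finite, C²,
finite range, ‖D²ṽ‖ ≤ Cₑ√ṽ) implies the conjunct for every repulsive finite-range potential (hard
cores, shells, kinks included). [difficulty: XL] -/
@[route_item "route-AtomisticToContinuum-BECInfraredUncertainty"]
def HardCoreExtension : Prop :=
  open Literature.MathematicalPhysics.QuantumManyBody.BoseGas in (∀ v : ℝ → ENNReal, IsRepulsiveFiniteRange v → (∀ r, v r ≠ ⊤) → ContDiff ℝ 2 (fun x : Space => (v ‖x‖).toReal) → (∃ Cₑ : ℝ, ∀ x : Space, ‖iteratedFDeriv ℝ 2 (fun x : Space => (v ‖x‖).toReal) x‖ ≤ Cₑ * Real.sqrt ((v ‖x‖).toReal)) → ∃ ρ₀ : ℝ, 0 < ρ₀ ∧ ∀ ρ : ℝ, 0 < ρ → ρ < ρ₀ → HasGroundStateBEC v ρ) → Literature.MathematicalPhysics.QuantumManyBody.BoseG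as.BoseEinsteinCondensation

/-- item stmt-AtomisticToContinuum-8324 · crux · rank 6 · closed · moot by None · by planner
why it might fail: beyond-Bogoliubov corrections at fixed kξ are O(√(ρa³)) and N → ∞ runs at fixed ρ, so an approach to ¼ from ABOVE by any positive amount at some kξ refutes it (IMU with C > ¼ survives); the card's two-body Wigner-molecule delimiter shows the constant is not universal outside fluids.
sources: Stringari1995, MoraCastin2003, GavoretNozieres1964, Griffin1993
[crux] (card K1 sharp form / P3, the headline; NOT load-bearing for the assembly) for every
smooth-class v and every window constant K > 0 there is ρ₀ > 0 such that for 0 < ρ < ρ₀, all large N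
and every positive minimiser on the torus of side (N/ρ)^{1/3}: Π_m = N·ν_m·S_m ≤ ¼ for every m ≠ 0
with |2πm/L| < K√ρ — conjugate domination with the Heisenberg constant, saturated from below as k →
0 (Bogoliubov closed form Π(x) = 1/[2(2+x)(1+x+√(x²+2x))]; card census: 56 exact ground states, max
Π always < ¼, XX chain Π₁ = 0.24896 at L = 256). [deps: InfraredMinimumUncertainty] [difficulty:
open-problem] -/
@[route_item "route-AtomisticToContinuum-BECInfraredUncertainty"]
def QuarterLaw : Prop :=
  open Literature.MathematicalPhysics.QuantumManyBody.BoseGas in ∀ v : ℝ → ENNReal, IsRepulsiveFiniteRange v → (∀ r, v r ≠ ⊤) → ContDiff ℝ 2 (fun x : Space => (v ‖x‖).toReal) → (∃ Cₑ : ℝ, ∀ x : Space, ‖iteratedFDeriv ℝ 2 (fun x : Space => (v ‖x‖).toReal) x‖ ≤ Cₑ * Real.sqrt ((v ‖x‖).toReal)) → ∀ K : ℝ, 0 < K → ∃ ρ₀ : ℝ, 0 < ρ₀ ∧ ∀ ρ : ℝ, 0 < ρ → ρ < ρ₀ → ∀ᶠ n : ℕ in Filter.atTop, ∀ Ψ :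 PeriodicTrialState (n + 1) (sideLength ρ (n + 1)), (let L : ℝ := sideLength ρ (n + 1); let g : Space → ℝ := fun r => ∫ x in cell L, ∫ Y in cellN n L, ‖Ψ.ψ (Matrix.vecCons (x + r) Y)‖ * ‖Ψ.ψ (Matrix.vecCons x Y)‖; let ν : (Fin 3 → ℤ) → ℝ := fun m => (cellFourierCoeff L (fun r : Space => ((Real.log (g r) : ℝ) : ℂ)) m).re; let S : (Fin 3 → ℤ) → ℝ := fun m => ((n : ℝ) + 1)⁻¹ * ∫ X in cellN (n + 1) L, ‖∑ j : Fin (n + 1), cellWave L m (X j)‖ ^ 2 * ‖Ψ.ψ X‖ ^ 2; let kn : (Fin 3 → ℤ) → ℝ := fun m => ‖((2 * Real.pi / L) • latticeVec 1 m)‖; periodicEnergy v Ψ = periodicGroundStateEnergy v (n + 1) L → periodicEnergy v Ψ ≠ ⊤ → (∀ X, Ψ.ψ X = (‖Ψ.ψ X‖ : ℂ)) → (∀ X, Ψ.ψ X ≠ 0) → ∀ m : Fin 3 → ℤ, m ≠ 0 → kn m < K * Real.sqrt ρ → ((n : ℝ) + 1) * ν m * S m ≤ 1 / 4)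

/-- item stmt-AtomisticToContinuum-6740 · support · rank 9 · closed · moot by None · by planner
sources: ReedSimonIV1978, LSSY2005
[support] at fixed N, L: for every ε > 0 there is δ > 0 such that every δ-near-minimiser Φ has
condensateOccupation ≥ that of a minimiser Ψ minus εN (discrete spectrum and simple ground state by
positivity improvement: ‖Φ − e^{iθ}Ψ‖² ≤ δ/gap; n₀ is 2N-Lipschitz in L²). [difficulty: M] -/
@[route_item "route-AtomisticToContinuum-BECInfraredUncertainty"]
def NearMinimiserStability : Prop :=
  open Literature.MathematicalPhysics.QuantumManyBody.BoseGas in ∀ v : ℝ → ENNReal, IsRepulsiveFiniteRange v → (∀ r, v r ≠ ⊤) → ContDiff ℝ 2 (fun x : Space => (v ‖x‖).toReal) → (∃ Cₑ : ℝ, ∀ x : Space, ‖iteratedFDeriv ℝ 2 (fun x : Space => (v ‖x‖).toReal) x‖ ≤ Cₑ * Real.sqrt ((v ‖x‖).toReal)) → ∀ N : ℕ, ∀ L : ℝ, 0 < L → periodicGroundStateEnergy v N L ≠ ⊤ → ∀ ε : ℝ, 0 < ε → ∃ δ : ENNReal, 0 < δ ∧ ∀ Ψ Φ : PeriodicTrialState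 N L, periodicEnergy v Ψ = periodicGroundStateEnergy v N L → periodicEnergy v Φ ≤ periodicGroundStateEnergy v N L + δ → condensateOccupation N L Ψ.ψ ≤ condensateOccupation N L Φ.ψ + ENNReal.ofReal (ε * N)

/-- item stmt-AtomisticToContinuum-8325 · support · rank 9 · closed · moot by None · by planner
sources: ReedSimonIV1978, LSSY2005
[support] for every smooth-class v, every N = n+1 ≥ 1 and L > 0 the periodic N-body energy has a
minimiser in the C¹ periodic Bose class which is C³, has finite energy, and is pointwise strictly
positive (Rellich on the torus, elliptic regularity for V ∈ C², bosonic ground state = absolute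
ground state, Perron–Frobenius / positivity improvement). [difficulty: L] -/
@[route_item "route-AtomisticToContinuum-BECInfraredUncertainty"]
def PositiveMinimiser : Prop :=
  open Literature.MathematicalPhysics.QuantumManyBody.BoseGas in ∀ v : ℝ → ENNReal, IsRepulsiveFiniteRange v → (∀ r, v r ≠ ⊤) → ContDiff ℝ 2 (fun x : Space => (v ‖x‖).toReal) → (∃ Cₑ : ℝ, ∀ x : Space, ‖iteratedFDeriv ℝ 2 (fun x : Space => (v ‖x‖).toReal) x‖ ≤ Cₑ * Real.sqrt ((v ‖x‖).toReal)) → ∀ n : ℕ, ∀ L : ℝ, 0 < L → ∃ Ψ : PeriodicTrialState (n + 1) L, periodicEnergy v Ψ = periodicGroundStateEnergy v (n + 1) L ∧ periodicEnergy v Ψ ≠ ⊤ ∧ ContDiff ℝ 3 Ψ.ψ ∧ (∀ X, Ψ.ψ X = (‖Ψ.ψ X‖ : ℂ)) ∧ (∀ X, Ψ.ψ X ≠ 0)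

/-- item stmt-AtomisticToContinuum-8326 · support · rank 9 · closed · moot by None · by planner
sources: PitaevskiiStringari1991, LSSY2005
[support] (companion card M5 / kinetic short-distance coherence, provable now) for every periodic C¹
trial state Ψ of N = n+1 bosons on the torus of side L > 0 with finite kinetic energy T =
∫_{cell^N}|∇Ψ|² and every r ∈ ℝ³: g(r) := ∫_cell∫_{cell^n}|Ψ(x+r,Y)||Ψ(x,Y)| ≥ 1 − |r|²T/(2N).
Proof: 1 − Re∫∫Ψ(x+r,Y)Ψ̄(x,Y) = ½‖Ψ(·+r) − Ψ‖² ≤ ½|r|²∫|∇₁Ψ|² = |r|²T/2N by periodicity, the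
fundamental theorem along the segment and Bose symmetry. [difficulty: provable-now] -/
@[route_item "route-AtomisticToContinuum-BECInfraredUncertainty"]
def ShortDistanceCoherence : Prop :=
  open Literature.MathematicalPhysics.QuantumManyBody.BoseGas in ∀ n : ℕ, ∀ L : ℝ, 0 < L → ∀ Ψ : PeriodicTrialState (n + 1) L, (∫⁻ X in cellN (n + 1) L, kineticDensity Ψ.ψ X) ≠ ⊤ → ∀ r : Space, 1 - ‖r‖ ^ 2 * (∫⁻ X in cellN (n + 1) L, kineticDensity Ψ.ψ X).toReal / (2 * ((n : ℝ) + 1)) ≤ ∫ x in cell L, ∫ Y in cellN n L, ‖Ψ.ψ (Matrix.vecCons (x + r) Y)‖ * ‖Ψ.ψ (Matrix.vecCons x Y)‖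

/-- item stmt-AtomisticToContinuum-8327 · support · rank 9 · closed · moot by None · by planner
sources: Stringari1995, MoraCastin2003, LSSY2005
[support] (glue of the thesis; kind glue) PositiveMinimiser → NearMinimiserStability →
ShortDistanceCoherence → PuffFloor → InfraredMinimumUncertainty → SmoothPeriodicBEC. Bookkeeping for
fixed smooth-class v: (i) n₀(Ψ)/N = V⁻¹∫_cell g for Ψ > 0 (unfold condensateOccupation, substitute
x' = x + r using periodicity); (ii) Jensen: log(V⁻¹∫g) ≥ V⁻¹∫log g = ĉ₀(log g); (iii) Parseval on
the cell with φ = V·(η_κ∗η_κ), η ∈ C_c^∞(B_{1/2}), η ≥ 0, ∫η = 1, η_κ = κ³η(κ·): ĉ₀(log g) = V⁻¹∫φ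
log g − Σ_{m≠0} |η̂(k/κ)|² ν_m; (iv) ShortDistanceCoherence + T ≤ periodicEnergy = E₀^per ≤ ρ‖ṽ‖₁N/2
(constant trial state) give V⁻¹∫φ log g ≥ log(1 − ‖ṽ‖₁/4K²) with κ = K√ρ, 1/κ < L/2; (v) IMU +
PuffFloor: ν_m ≤ C₁√(|k|²+C₂ρ)/(N|k|), and the lattice sums Σ_m|η̂(k/κ)|² ≤ c_ηVκ³,
Σ_{m≠0}|η̂(k/κ)|²/|k| ≤ c'_ηVκ² (L ≥ 1/κ) give Σ ≤ C₁(c_ηK³ + c'_η√C₂K²)√ρ; (vi) choose K² ≥ 2‖ṽ‖₁,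
then ρ₀ small: n₀(Ψ) ≥ N/2 for the positive minimiser, and NearMinimiserStability with ε = ¼ yields
δ > 0 with n₀ ≥ N/4 for all δ-near-minimisers, i.e. SmoothPeriodicBEC with c = ¼. [difficulty: L] -/
@[route_item "route-AtomisticToContinuum-BECInfraredUncertainty"]
def IMUChainGlue : Prop :=
  PositiveMinimiser → NearMinimiserStability → ShortDistanceCoherence → PuffFloor → InfraredMinimumUncertainty → SmoothPeriodicBEC

/-- item stmt-AtomisticToContinuum-8328 · assembly · rank 1 · closed · moot by None · by planner
sources: LSSY2005, Stringari1995
[assembly] InfraredMinimumUncertainty → PuffFloor → ShortDistanceCoherence → PositiveMinimiser →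
NearMinimiserStability → IMUChainGlue → BoundaryTransferWeak → HardCoreExtension →
BoseEinsteinCondensation. -/
@[route_item "route-AtomisticToContinuum-BECInfraredUncertainty"]
def Assembly : Prop :=
  InfraredMinimumUncertainty → PuffFloor → ShortDistanceCoherence → PositiveMinimiser → NearMinimiserStability → IMUChainGlue → BoundaryTransferWeak → HardCoreExtension → Literature.MathematicalPhysics.QuantumManyBody.BoseGas.BoseEinsteinCondensation

end Summit.AtomisticToContinuum.BoseEinsteinCondensation.Theses.BECInfraredUncertainty
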